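import Literature.Topology.PlaneTopology.ArgumentIncrement
import Mathlib.Analysis.Calculus.Deriv.Basic
import Mathlib.Analysis.SpecialFunctions.Complex.Log
import HarnessLib

/-!
# Three index lemmas: far points, small circles under holomorphic maps, and frontier points

Bookkeeping for winding numbers (`Literature.Topology.PlaneTopology.wind`, `WindingNumber.lean`)
used in the deterministic proof of the sector claim of [LSW] Lemma 6.3
(`Literature/Probability/RandomPlanarGeometry/SLERestrictionHitPath*`), where the two sides of the
image `g_T ∘ β` of a hit path are told apart by the index of the image of a small circle:

* `wind_sub_eq_zero_of_norm_sub_lt` — a loop staying in a disc about `c` has index `0` about every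
  point outside that disc; `wind_sub_eq_zero_of_im_pos` — a loop in the open upper half-plane has
  index `0` about every point of the closed lower half-plane (principal logarithm);
* `exists_wind_comp_circleLoop_eq_one` — **small circles keep index one under a map with
  non-vanishing derivative**: if `f` is complex differentiable on an open set `U ∋ c` with
  `f' (c) ≠ 0`, then for all small `δ > 0` the loop `t ↦ f (c + δ e^{2πit}) - f c` has winding
  number `1` about `0` (Rouché for loops, `wind_eq_of_norm_sub_lt`, against `f'(c) δ e^{2πit}`);
* `wind_sub_eq_zero_of_mem_closure`, `wind_sub_ne_zero_of_mem_closure` — **a loop cannot wind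
  around a limit point of a connected set it avoids, if it has index `0` about some point of that
  set**: winding numbers are constant
  on complementary components (`wind_sub_eq_of_mem_connectedComponentIn`, Eilenberg) and locally
  constant near points off the loop. Applied to the two complementary components `U`, `V` of a
  Jordan curve (`JordanCurveTheorem.symmetric`), it says that a small loop of index `1` about a
  point of the curve meets both `U` and `V`.

Everything is proved; all statements are folklore (Ahlfors, *Complex Analysis*, 3rd ed., §4.2).
-/

noncomputable section

open Set Filter Metric
open _root_.Complex _root_.Topology
open Literature.Topology.PlaneTopology

namespace Literature.Analysis.Complex

/-! ### Index zero: far points and points below a loop in the upper half-plane -/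

/-- **A loop inside a disc does not wind around points outside it.** If `‖Γ t - c‖ < ‖p - c‖` on
`[0, 1]` then `wind (Γ - p) = 0`. [folklore] -/
theorem wind_sub_eq_zero_of_norm_sub_lt {Γ : ℝ → ℂ} (hΓ : ContinuousOn Γ (Icc 0 1))
    (h01 : Γ 0 = Γ 1) {c p : ℂ} (h : ∀ t ∈ Icc (0 : ℝ) 1, ‖Γ t - c‖ < ‖p - c‖) :
    wind (fun t ↦ Γ t - p) = 0 := by
  have hcp : c - p ≠ 0 := by
    intro h0
    have := h 0 ⟨le_rfl, zero_le_one⟩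
    rw [sub_eq_zero.1 h0, sub_self, norm_zero] at this
    exact absurd this (not_lt.2 (norm_nonneg _))
  have hg : IsNonvanishingLoop fun _ : ℝ ↦ c - p := IsNonvanishingLoop.const hcp
  have := wind_eq_of_norm_sub_lt (f := fun t ↦ Γ t - p) (g := fun _ ↦ c - p)
    (hΓ.sub continuousOn_const) (by simp [h01]) hg (fun t ht ↦ by
      have e : Γ t - p - (c - p) = Γ t - c := by ring
      rw [e, norm_sub_rev c p]
      exact h t ht)
  rw [this]
  exact wind_const _

/-- **A loop in the open upper half-plane does not wind around points on or below the real
axis.** [folklore] -/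
theorem wind_sub_eq_zero_of_im_pos {Γ : ℝ → ℂ} (hΓ : ContinuousOn Γ (Icc 0 1)) (h01 : Γ 0 = Γ 1)
    (him : ∀ t ∈ Icc (0 : ℝ) 1, 0 < (Γ t).im) {p : ℂ} (hp : p.im ≤ 0) :
    wind (fun t ↦ Γ t - p) = 0 := by
  have hmem : ∀ t ∈ Icc (0 : ℝ) 1, Γ t - p ∈ slitPlane := fun t ht ↦
    Or.inr (by rw [sub_im]; linarith [him t ht])
  have hloop : IsNonvanishingLoop fun t ↦ Γ t - p :=
    ⟨hΓ.sub continuousOn_const, fun t ht ↦ slitPlane_ne_zero (hmem t ht), by simp [h01]⟩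
  exact (wind_eq_zero_iff hloop).2 ⟨fun t ↦ log (Γ t - p), (hΓ.sub continuousOn_const).clog hmem,
    fun t ht ↦ exp_log (slitPlane_ne_zero (hmem t ht)), by simp [h01]⟩

/-! ### Small circles keep index one under holomorphic maps with non-vanishing derivative -/

/-- **Small circles about `c` are mapped to loops of index one about `f c`.** If `f` is complex
differentiable on an open set `U ∋ c` with `deriv f c ≠ 0`, there is `δ₀ > 0` such that for every
`0 < δ < δ₀` the loop `t ↦ f (c + δ e^{2πit}) - f c` winds once around `0` (Rouché for loops,
against the linear loop `f'(c) · δ e^{2πit}`). [folklore] -/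
theorem exists_wind_comp_circleLoop_eq_one {f : ℂ → ℂ} {U : Set ℂ} (hU : IsOpen U) {c : ℂ}
    (hc : c ∈ U) (hf : DifferentiableOn ℂ f U) (hf' : deriv f c ≠ 0) :
    ∃ δ₀ > 0, ∀ δ ∈ Ioo (0 : ℝ) δ₀, wind (fun t ↦ f (circleLoop c δ t) - f c) = 1 := by
  have hd : HasDerivAt f (deriv f c) c := (hf.differentiableAt (hU.mem_nhds hc)).hasDerivAt
  set f' := deriv f c with hf'def
  have hn : 0 < ‖f'‖ := norm_pos_iff.2 hf'
  -- the little-o estimate with constant `‖f'‖/2`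
  rw [hasDerivAt_iff_isLittleO, Asymptotics.isLittleO_iff] at hd
  have hε : (0 : ℝ) < ‖f'‖ / 2 := by positivity
  obtain ⟨ρ, hρ, hρU⟩ := Metric.isOpen_iff.1 hU c hc
  obtain ⟨δ₁, hδ₁, hest⟩ := Metric.eventually_nhds_iff.1 (hd hε)
  refine ⟨min ρ δ₁, lt_min hρ hδ₁, fun δ hδ ↦ ?_⟩
  have hδρ : δ < ρ := lt_of_lt_of_le hδ.2 (min_le_left _ _)
  have hδδ₁ : δ < δ₁ := lt_of_lt_of_le hδ.2 (min_le_right _ _)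
  -- the comparison loop `g t = f' · δ e^{2πit}`
  have hcirc : IsNonvanishingLoop (circleLoop 0 δ) := by
    refine isNonvanishingLoop_circleLoop ?_
    rw [norm_zero, abs_of_pos hδ.1]; exact hδ.1.ne
  have hg : IsNonvanishingLoop fun t ↦ f' * circleLoop 0 δ t := (IsNonvanishingLoop.const hf').mul hcirc
  have hwg : wind (fun t ↦ f' * circleLoop 0 δ t) = 1 := by
    rw [wind_mul (IsNonvanishingLoop.const hf') hcirc, wind_const, wind_circleLoop_zero hδ.1, zero_add]
  -- continuity of the image loop
  have hsub : ∀ t, circleLoop c δ t ∈ U := fun t ↦ hρU (by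
    rw [mem_ball, dist_eq_norm, norm_circleLoop_sub_center, abs_of_pos hδ.1]; exact hδρ)
  have hcont : ContinuousOn (fun t ↦ f (circleLoop c δ t) - f c) (Icc 0 1) :=
    ((hf.continuousOn.comp (continuous_circleLoop c δ).continuousOn fun t _ ↦ hsub t).sub
      continuousOn_const)
  rw [← hwg]
  refine wind_eq_of_norm_sub_lt hcont (by simp [circleLoop_zero_eq]) hg fun t _ ↦ ?_
  -- Rouché: `‖f(c+h) - f c - f' h‖ ≤ ‖f'‖/2 ‖h‖ < ‖f' h‖`
  have hh : circleLoop c δ t - c = circleLoop 0 δ t := by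
    rw [circleLoop_sub, sub_self]
  have hnorm : ‖circleLoop 0 δ t‖ = δ := by
    rw [← hh, norm_circleLoop_sub_center, abs_of_pos hδ.1]
  have hmem : circleLoop c δ t ∈ ball c δ₁ := by
    rw [mem_ball, dist_eq_norm, norm_circleLoop_sub_center, abs_of_pos hδ.1]; exact hδδ₁
  have h1 := hest hmem
  rw [hh] at h1
  have e : f (circleLoop c δ t) - f c - f' * circleLoop 0 δ t =
      f (circleLoop c δ t) - f c - (circleLoop 0 δ t) • f' := by
    rw [smul_eq_mul]; ring
  rw [e]
  calc ‖f (circleLoop c δ t) - f c - circleLoop 0 δ t • f'‖ ≤ ‖f'‖ / 2 * ‖circleLoop 0 δ t‖ := h1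
    _ < ‖f'‖ * ‖circleLoop 0 δ t‖ := by rw [hnorm]; nlinarith [hδ.1]
    _ = ‖f' * circleLoop 0 δ t‖ := (norm_mul _ _).symm

/-! ### A loop cannot wind around a limit point of a connected set it avoids -/

/-- **Index at limit points of avoided connected sets.** Let the loop `Γ` avoid the preconnected
set `V`, and let `ŵ ∈ closure V` be off the loop. If `Γ` has index `0` about some point of `V`,
then it has index `0` about `ŵ`: the index is constant on `V` (one complementary component of
the loop, Eilenberg) and near `ŵ`. For the two complementary components of a Jordan curve this
says that a loop of non-zero index about a point of the curve meets both components. [folklore] -/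
theorem wind_sub_eq_zero_of_mem_closure {Γ : ℝ → ℂ} (hΓ : ContinuousOn Γ (Icc 0 1))
    (h01 : Γ 0 = Γ 1) {V : Set ℂ} (hV : IsPreconnected V) (hΓV : ∀ t ∈ Icc (0 : ℝ) 1, Γ t ∉ V)
    {ŵ : ℂ} (hŵ : ŵ ∈ closure V) (hŵΓ : ∀ t ∈ Icc (0 : ℝ) 1, Γ t ≠ ŵ) {v₀ : ℂ} (hv₀ : v₀ ∈ V)
    (hv₀w : wind (fun t ↦ Γ t - v₀) = 0) : wind (fun t ↦ Γ t - ŵ) = 0 := by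
  -- the compact trace of the loop
  set K : Set ℂ := Γ '' Icc 0 1 with hK
  have hKc : IsCompact K := isCompact_Icc.image_of_continuousOn hΓ
  have hKcl : IsClosed K := hKc.isClosed
  have hmaps : MapsTo Γ (Icc 0 1) K := fun t ht ↦ mem_image_of_mem Γ ht
  have hŵK : ŵ ∉ K := by
    rintro ⟨t, ht, rfl⟩
    exact hŵΓ t ht rfl
  have hVK : V ⊆ Kᶜ := by
    rintro v hv ⟨t, ht, rfl⟩
    exact hΓV t ht hv
  -- a point of `V` close to `ŵ`, in the component of `ŵ`
  have hd : 0 < infDist ŵ K := by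
    rcases K.eq_empty_or_nonempty with hKe | hKne
    · exact absurd (hmaps ⟨le_rfl, zero_le_one⟩) (by rw [hKe]; exact notMem_empty _)
    · exact (hKcl.notMem_iff_infDist_pos hKne).1 hŵK
  obtain ⟨v, hvV, hvd⟩ := Metric.mem_closure_iff.1 hŵ _ hd
  have hball : ball ŵ (infDist ŵ K) ⊆ Kᶜ := by
    intro z hz hzK
    have h1 : infDist ŵ K ≤ dist ŵ z := infDist_le_dist_of_mem hzK
    rw [mem_ball, dist_comm] at hz
    linarith
  have hv_comp : v ∈ connectedComponentIn Kᶜ ŵ :=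
    (convex_ball ŵ _).isPreconnected.subset_connectedComponentIn (mem_ball_self hd) hball
      (by rw [mem_ball, dist_comm]; exact hvd)
  have hv₀_comp : v₀ ∈ connectedComponentIn Kᶜ v := hV.subset_connectedComponentIn hvV hVK hv₀
  rw [wind_sub_eq_of_mem_connectedComponentIn hΓ h01 hKcl hmaps hv_comp,
    wind_sub_eq_of_mem_connectedComponentIn hΓ h01 hKcl hmaps hv₀_comp, hv₀w]

/-- **Contrapositive form.** A loop avoiding the preconnected set `V`, with non-zero index about a
point `ŵ ∈ closure V` off the loop, has non-zero index about EVERY point of `V`; in particular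
`V` is bounded by the trace of the loop (cf. `wind_sub_eq_zero_of_norm_sub_lt`). [folklore] -/
theorem wind_sub_ne_zero_of_mem_closure {Γ : ℝ → ℂ} (hΓ : ContinuousOn Γ (Icc 0 1))
    (h01 : Γ 0 = Γ 1) {V : Set ℂ} (hV : IsPreconnected V) (hΓV : ∀ t ∈ Icc (0 : ℝ) 1, Γ t ∉ V)
    {ŵ : ℂ} (hŵ : ŵ ∈ closure V) (hŵΓ : ∀ t ∈ Icc (0 : ℝ) 1, Γ t ≠ ŵ)
    (hw : wind (fun t ↦ Γ t - ŵ) ≠ 0) {v₀ : ℂ} (hv₀ : v₀ ∈ V) :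
    wind (fun t ↦ Γ t - v₀) ≠ 0 := fun h ↦
  hw (wind_sub_eq_zero_of_mem_closure hΓ h01 hV hΓV hŵ hŵΓ hv₀ h)

end Literature.Analysis.Complex
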